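import Mathlib
import Summits.PneNP.PneNP.Theorems.ClusUniversalCertificateCoordDefs

/-!
# Route ClusUniversalCertificate, crux `UniversalCertAll` (stmt-PneNP-19683) — the SATURATION BOUND (Hall level one)

Support file (`--supports stmt-PneNP-19683`), objects of record `…Theorems.ClusCoord` (`bsize`, `zcount`).

A point `y ∈ Y ⊆ 𝔽₂^M` is `j`-SATURATED if `y + w ∈ Y` for every `w` supported in block `j` (the whole block-`j` fibre through `y`
lies in `Y`).  **Saturation bound (`card_sat_le`, `card_sat_le_zcount`).**  For every pattern `x`,
`#{y ∈ Y : y is j-saturated} ≤ 2^{b_j} · #{y ∈ Y : y ≡ x on block j}`, in particular `≤ 2^{b_j} Z_j(Y)`.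
Proof: `y ↦ (y|_{B_j}, y with block j overwritten by x)` (no new definitions) is injective into `(B_j → 𝔽₂) × (Y ∩ fibre of x)`.

USE (line `slicing`, stub `stub_core`).  In the positive-part form `UC⁺ : Σ_y (n − acodim y)⁺ ≤ Σ_j 2^{b_j} μ_j` of the certificate, the
demand of the points whose optimal flat is onto NO block other than `j` is carried by `j`-saturated points (a flat of codimension `n − 1`
that is onto block `j` only is a box `V_j × Π_{k ≠ j} H_k`), so this bound is the level-`|J| = 1` case of the Hall family
`HF(J) : Σ_{y : onto-blocks(A_y) ⊆ J} (n − acodim y)⁺ ≤ Σ_{j ∈ J} 2^{b_j} μ_j`; it is the TRUE box form of the refuted section rule OBL-∃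
(record: Cruxes/UniversalCertAll, line-section-induction.dead.md — W130).  HONEST FRAMING: a support lemma; the crux is OPEN; FRONTIER rung
F-N1 — nothing here bears on P vs NP.
-/

set_option linter.dupNamespace false -- `Summit.PneNP.PneNP.…`: summit = sub-problem name (D-0017 single-conjunct layout)

namespace Summit.PneNP.PneNP.Theorems.ClusCoordSaturation

open Finset
open Summit.PneNP.PneNP.Theorems.ClusCoord (bsize zcount)

variable {M n : ℕ}

/-- **Saturation bound (fibre form).**  The `j`-saturated points of `Y` number at most `2^{b_j}` times any block-`j` fibre of `Y`. -/
theorem card_sat_le (blk : Fin M → Fin n) (j : Fin n) (Y : Finset (Fin M → ZMod 2)) (x : Fin M → ZMod 2) :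
    (Y.filter fun y => ∀ w : Fin M → ZMod 2, (∀ i, blk i ≠ j → w i = 0) → y + w ∈ Y).card ≤
      2 ^ bsize blk j * (Y.filter fun y => ∀ i, blk i = j → y i = x i).card := by
  classical
  set S := Y.filter fun y => ∀ w : Fin M → ZMod 2, (∀ i, blk i ≠ j → w i = 0) → y + w ∈ Y with hS
  set F := Y.filter fun y => ∀ i, blk i = j → y i = x i with hF
  -- the injection `y ↦ (y|_{B_j}, overwrite)` into `(B_j → 𝔽₂) × F`
  let f : (Fin M → ZMod 2) → ({i : Fin M // blk i = j} → ZMod 2) × (Fin M → ZMod 2) :=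
    fun y => (fun i => y i, fun i => if blk i = j then x i else y i)
  have hmaps : ∀ y ∈ S, f y ∈ (Finset.univ : Finset ({i : Fin M // blk i = j} → ZMod 2)) ×ˢ F := by
    intro y hy
    rw [hS, Finset.mem_filter] at hy
    refine Finset.mem_product.mpr ⟨Finset.mem_univ _, ?_⟩
    rw [hF, Finset.mem_filter]
    refine ⟨?_, fun i hi => by simp [f, hi]⟩
    show (fun i => if blk i = j then x i else y i) ∈ Y
    -- `overwrite blk j x y = y + w` with `w` supported in block `j`
    have hw := hy.2 (fun i => if blk i = j then x i - y i else 0) (fun i hi => by simp [hi])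
    have : (fun i => if blk i = j then x i else y i) = y + fun i => if blk i = j then x i - y i else 0 := by
      funext i
      by_cases hi : blk i = j <;> simp [hi]
    rw [this]; exact hw
  have hinj : Set.InjOn f S := by
    intro y _ y' _ h
    have h1 : (fun i : {i : Fin M // blk i = j} => y (i : Fin M)) =
        fun i : {i : Fin M // blk i = j} => y' (i : Fin M) := congrArg Prod.fst h
    have h2 : (fun i => if blk i = j then x i else y i) = fun i => if blk i = j then x i else y' i :=
      congrArg Prod.snd h
    funext i
    by_cases hi : blk i = j
    · exact congrFun h1 ⟨i, hi⟩
    · have := congrFun h2 i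
      simpa [hi] using this
  calc S.card ≤ ((Finset.univ : Finset ({i : Fin M // blk i = j} → ZMod 2)) ×ˢ F).card :=
        Finset.card_le_card_of_injOn f hmaps hinj
    _ = 2 ^ bsize blk j * F.card := by
        rw [Finset.card_product, Finset.card_univ, Fintype.card_fun, ZMod.card, Fintype.card_subtype]
        rfl

/-- **Saturation bound (zero form).**  `#{j-saturated points of Y} ≤ 2^{b_j} · Z_j(Y)`. -/
theorem card_sat_le_zcount (blk : Fin M → Fin n) (j : Fin n) (Y : Finset (Fin M → ZMod 2)) :
    (Y.filter fun y => ∀ w : Fin M → ZMod 2, (∀ i, blk i ≠ j → w i = 0) → y + w ∈ Y).card ≤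
      2 ^ bsize blk j * zcount blk j Y := by
  have h := card_sat_le blk j Y 0
  unfold zcount
  simpa using h

end Summit.PneNP.PneNP.Theorems.ClusCoordSaturation
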